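import Summits.ABC.StewartYu.PadicG3TwoSeries
import Summits.ABC.StewartYu.PadicG3TwoValues
import Summits.ABC.StewartYu.PadicTwoKStep
import HarnessLib

/-!
# Cell abc-stewartyu, Gen-3 frame at `p = 2` (crux `Y07Two`, stmt-ABC-19659), layer F4b: the `2`-ADIC
# EXTRAPOLATION STEP (k-step) for the Gen-3 family — Schwarz at the integer nodes of BOTH signs, then Liouville

`Summits/ABC/StewartYu/PadicG3TwoKStep.lean` — cell `abc-stewartyu` (HOME `run/shared/lean/pub/abc-stewartyu/`),
route `PadicPrimesKummerThird`, seat p3 (g5), F-two LEAD (layer plan HOME/p3/memo-09 §3, F4).  Theorems on the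
M2 datum `TwoSetup`; no definition, no named fact.  Twin of lit's/p2's `PadicTwoKStep.norm_Φ_le_of_zeros3` /
`padic_kstep3` for the Gen-3 family `g3F`/`g3Φ`/`g3φ` (`PadicG3TwoFunctions`, `PadicG3TwoSeries`), with the
Gen-3 change that the nodes are ALL integers `x`, `|x| ≤ N` (Yu 2013 Lemma 5.2 evaluates at `|s| ≤ qᴶS`;
the `q`-descent shrinks the exponent box instead of thinning the points).

* `norm_hw_eval_le_of_wt` — on the unit disc the `Y₀`-weights are bounded by the frame's weighted
  coefficient bound `Bw` (`‖coeffₖ‖·4ᵏ ≤ Bw ⇒ ‖(hw i t₀)(z)‖ ≤ Bw` for `‖z‖ ≤ 1`);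
* **`norm_g3F_le_of_zeros`** — if the rational values `g3φ τ'' x` vanish for all `|x| ≤ N`, `|τ''| < Tlo`,
  then for `‖z‖ ≤ 1` and `|τ| + t ≤ Tlo`:
  `‖f_τ(z)‖, ‖φ_τ(z)‖ ≤ max (Bw·‖Λ₀‖·2ᵗ·2^{condExp 2 (2N+1) t}) (Bw / 4^{(2N+1)·t})`
  — the small-jets Schwarz lemma with levels (`PadicNewton.norm_tsum_le_max_of_small_jets_levels`, `ρ = 4`,
  `r = 1`) at the `2N+1` nodes `x ∈ [−N, N]` of multiplicity `t`, jets `≤ Bw·2‖Λ₀‖·2^{t−1}` through the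
  `f − φ` comparison, and the `2`-adic conditioning (nodes within `2^{−j}` agree mod `2ʲ`,
  `#{i < 2N+1 : i ≡ c (mod 2ʲ)} ≤ (2N+1)/2ʲ + 1`);
* **`g3_kstep`** — the k-step: vanishing at `|x| ≤ N` for `|τ| < Tlo` + the Liouville data of
  `PadicG3TwoValues.g3φ_eq_zero_of_norm_lt` at the new points `|x₁| ≤ N'` + the numerical inequality
  `max (…) (…) < 1/K` ⇒ vanishing at `|x₁| ≤ N'` for `|τ| + t ≤ Tlo`.

WHAT THIS IS NOT: no parameters (the record chooses `N, N', Tlo, t, Bw, K`); no Kummer descent; no crux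
moves.

References: K. Yu, Compositio Math. 74 (1990), Lemma 1.2, §3 (`p = 2`); K. Yu, Acta Math. 211 (2013),
Lemma 5.2, (5.23)–(5.31); M. Waldschmidt, Acta Arith. 37 (1980), Lemma 3.5.
-/

noncomputable section

open NormedSpace Finset IsUltrametricDist Polynomial Metric Filter
open Literature.NumberTheory.Transcendental
open Literature.NumberTheory.Transcendental.PadicCW77 (nodeSeq length_nodeSeq mem_nodeSeq count_nodeSeq
  countP_nodeSeq card_filter_range_mod_le condExp)
open scoped Nat Topology

namespace Summit.ABC.StewartYu

open Literature.NumberTheory.Transcendental.CW77.Setup (Tau tauNorm)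

namespace TwoSetup

variable (S : TwoSetup) {ι : Type*} (R : ι → ℚ[X]) (u : ι → Fin S.d → ℤ) (uθ : ι → ℤ)

/-! ### The `Y₀`-weights on the unit disc -/

/-- On `‖z‖ ≤ 1`, `‖(hw i t₀)(z)‖ ≤ Bw` if `‖coeffₖ(hw i t₀)‖·4ᵏ ≤ Bw` for all `k`. [folklore] -/
theorem norm_hw_eval_le_of_wt (i : ι) (t₀ : ℕ) {Bw : ℝ} (hBw0 : 0 ≤ Bw)
    (hBw : ∀ k, ‖(hw R i t₀).coeff k‖ * 4 ^ k ≤ Bw) {z : ℚ_[2]} (hz : ‖z‖ ≤ 1) :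
    ‖(hw R i t₀).eval z‖ ≤ Bw := by
  rw [hw_eval_eq_sum]
  refine norm_sum_le_of_forall_le_of_nonneg hBw0 fun k _ => ?_
  unfold g3wC
  rw [norm_mul, norm_pow]
  have h4 : (1 : ℝ) ≤ 4 ^ k := one_le_pow₀ (by norm_num)
  calc ‖(hw R i t₀).coeff k‖ * ‖z‖ ^ k ≤ ‖(hw R i t₀).coeff k‖ * 1 :=
        mul_le_mul_of_nonneg_left (pow_le_one₀ (norm_nonneg _) hz) (norm_nonneg _)
    _ ≤ ‖(hw R i t₀).coeff k‖ * 4 ^ k := mul_le_mul_of_nonneg_left h4 (norm_nonneg _)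
    _ ≤ Bw := hBw k

/-! ### The extrapolation bound from zeros at the integer nodes `|x| ≤ N` -/

/-- **The `2`-adic extrapolation bound for the Gen-3 family.** If `g3φ τ'' x = 0` for all integers
`|x| ≤ N` and all `|τ''| < Tlo`, and the `Y₀`-weights satisfy `‖coeffₖ(hw i t₀)‖·4ᵏ ≤ Bw` (all `i ∈ B`,
`t₀`, `k`), then for `‖z‖ ≤ 1` and `|τ| + t ≤ Tlo` (`t ≥ 1`):
`‖f_τ(z)‖ ≤ max (Bw·‖Λ₀‖·2ᵗ·2^{condExp 2 (2N+1) t}) (Bw / 4^{(2N+1)·t})`, and the same for `φ_τ(z)`.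
[cite: Yu1990, Lemma 1.2 and §3] [cite: Yu2013, Lemma 5.2] -/
theorem norm_g3F_le_of_zeros (B : Finset ι) (p : ι → ℤ) {N Tlo t : ℕ} (ht : 1 ≤ t)
    {Bw : ℝ} (hBw0 : 0 ≤ Bw) (hBw : ∀ i ∈ B, ∀ t₀ k, ‖(hw R i t₀).coeff k‖ * 4 ^ k ≤ Bw)
    (hzero : ∀ x : ℤ, |x| ≤ (N : ℤ) → ∀ τ'' : Tau S.d, tauNorm τ'' < Tlo →
      S.g3φ R u uθ B p τ'' x = 0)
    {z : ℚ_[2]} (hz : ‖z‖ ≤ 1) (τ : Tau S.d) (hτ : tauNorm τ + t ≤ Tlo) :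
    ‖S.g3F R u uθ B p τ z‖ ≤
        max (Bw * ‖S.Λ₀‖ * (2 : ℝ) ^ t * (2 : ℝ) ^ condExp 2 (2 * N + 1) t)
          (Bw / (4 : ℝ) ^ ((2 * N + 1) * t)) ∧
      ‖S.g3Φ R u uθ B p τ z‖ ≤
        max (Bw * ‖S.Λ₀‖ * (2 : ℝ) ^ t * (2 : ℝ) ^ condExp 2 (2 * N + 1) t)
          (Bw / (4 : ℝ) ^ ((2 * N + 1) * t)) := by
  classical
  have hTlo : 1 ≤ Tlo := by omega
  set kpts : ℕ := 2 * N + 1 with hkpts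
  set Pt : ℝ := (2 : ℝ) ^ (t - 1) with hPt
  set ρ : ℝ := 4 with hρdef
  have hρ : 0 < ρ := by norm_num
  have h1ρ : (1 : ℝ) < ρ := by norm_num
  have hΛ0 : 0 ≤ ‖S.Λ₀‖ := norm_nonneg _
  -- (a) the `f − φ` comparison on the unit disc with `Q := Bw`
  have hz2 : ∀ z : ℚ_[2], ‖z‖ ≤ 1 → ‖z‖ ≤ 2 := fun z hz => hz.trans (by norm_num)
  have hQ : ∀ (τ' : Tau S.d) (z : ℚ_[2]), ‖z‖ ≤ 1 → ∀ i ∈ B, ‖(hw R i τ'.1).eval z‖ ≤ Bw :=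
    fun τ' z hz i hi => norm_hw_eval_le_of_wt R i τ'.1 hBw0 (hBw i hi τ'.1) hz
  have hFΦ : ∀ (τ' : Tau S.d) (z : ℚ_[2]), ‖z‖ ≤ 1 →
      ‖S.g3F R u uθ B p τ' z - S.g3Φ R u uθ B p τ' z‖ ≤ Bw * (2 * ‖S.Λ₀‖) := fun τ' z hz =>
    S.norm_g3F_sub_g3Φ_le R u uθ B p τ' (hz2 z hz) hBw0 (hQ τ' z hz)
  -- integers lie in the unit disc
  have hint : ∀ x : ℤ, ‖(x : ℚ_[2])‖ ≤ 1 := fun x => Padic.norm_int_le_one (p := 2) x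
  -- the nodes `node i = i − N`, `i < 2N+1`
  set node : ℕ → ℚ_[2] := fun i => (((i : ℤ) - N : ℤ) : ℚ_[2]) with hnode
  have hnodeZ : ∀ i < kpts, |((i : ℤ) - N)| ≤ (N : ℤ) := by
    intro i hi; rw [abs_le]; constructor <;> omega
  -- (b) values at the nodes
  have hval : ∀ i < kpts, ∀ τ' : Tau S.d, tauNorm τ' ≤ Tlo - 1 →
      ‖S.g3F R u uθ B p τ' (node i)‖ ≤ Bw * (2 * ‖S.Λ₀‖) := by
    intro i hi τ' hτ'
    have h0 : S.g3Φ R u uθ B p τ' (node i) = 0 := by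
      simp only [hnode]
      rw [S.g3Φ_intCast, hzero _ (hnodeZ i hi) τ' (by omega), Rat.cast_zero]
    have := hFΦ τ' (node i) (by simp only [hnode]; exact hint _)
    rwa [h0, sub_zero] at this
  -- the coefficient sequence and its weighted bound
  set b : ℕ → ℚ_[2] := S.coeffG3F R u uθ B p τ with hb
  have hbB : PadicNewton.WtBdd ρ Bw b := S.wtBdd_coeffG3F R u uθ B p τ hBw0 (fun i hi k => hBw i hi τ.1 k)
  -- the node set
  set nodes : Finset ℚ_[2] := (range kpts).image node with hnodes
  have hmem : ∀ a ∈ nodes, ∃ i < kpts, a = node i := by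
    intro a ha
    obtain ⟨i, hi, rfl⟩ := mem_image.mp ha
    exact ⟨i, mem_range.mp hi, rfl⟩
  have hnod : ∀ a ∈ nodes, ‖a‖ ≤ 1 := by
    intro a ha; obtain ⟨i, -, rfl⟩ := hmem a ha; simp only [hnode]; exact hint _
  -- differences of nodes are the integers `i − i'`
  have hdiff : ∀ i i' : ℕ, node i - node i' = (((i : ℤ) - i' : ℤ) : ℚ_[2]) := by
    intro i i'; simp only [hnode]; push_cast; ring
  -- the level structure: radii `R0 j = 2^{-j}`, levels `R j = R0 (min j Jm)`, `Jm = ⌊log₂ kpts⌋`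
  set R0 : ℕ → ℝ := fun j => ((2 : ℝ)⁻¹) ^ j with hR0def
  have hR0pos : ∀ j, 0 < R0 j := fun j => by simp only [hR0def]; positivity
  have hR0anti : ∀ a b, a ≤ b → R0 b ≤ R0 a := fun a b hab => by
    simp only [hR0def]
    exact pow_le_pow_of_le_one (by positivity) (by norm_num) hab
  have hR0ratio : ∀ j, R0 j / R0 (j + 1) = 2 := by
    intro j; simp only [hR0def, pow_succ]; field_simp
  have hR0zpow : ∀ j : ℕ, R0 j = ((2 : ℕ) : ℝ) ^ (-(j : ℤ)) := fun j => by
    simp only [hR0def, zpow_neg, zpow_natCast, inv_pow]; norm_num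
  set Jm : ℕ := Nat.log 2 kpts with hJm
  set Rl : ℕ → ℝ := fun j => R0 (min j Jm) with hRl
  have hRl0 : Rl 0 = 1 := by simp [hRl, hR0def]
  have hRlpos : ∀ j, 0 < Rl j := fun j => hR0pos _
  have hRlanti : ∀ j, Rl (j + 1) ≤ Rl j := fun j =>
    hR0anti _ _ (min_le_min (Nat.le_succ j) le_rfl)
  have hlev : ∀ a ∈ nodes, ∀ a' ∈ nodes, a ≠ a' → ∃ j < Jm + 1, ‖a - a'‖ = Rl j := by
    intro a ha a' ha' hne
    obtain ⟨i, hi, rfl⟩ := hmem a ha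
    obtain ⟨i', hi', rfl⟩ := hmem a' ha'
    set m : ℤ := (i : ℤ) - i' with hm
    have hm0 : m ≠ 0 := by
      intro h0; apply hne
      have : (i : ℤ) = i' := by omega
      have : i = i' := by exact_mod_cast this
      simp only [hnode, this]
    have hmabs : m.natAbs ≤ kpts := by omega
    -- `v = ord₂ m ≤ Jm` since `2^v ≤ |m| ≤ kpts`
    have hdvd : 2 ^ padicValInt 2 m ∣ m.natAbs := by
      have h1 := Int.natAbs_dvd_natAbs.mpr (padicValInt_dvd (p := 2) m)
      simpa [Int.natAbs_pow] using h1
    have hvle : padicValInt 2 m ≤ Jm := by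
      have h2 : 2 ^ padicValInt 2 m ≤ kpts :=
        (Nat.le_of_dvd (Int.natAbs_pos.mpr hm0) hdvd).trans hmabs
      exact Nat.le_log_of_pow_le (by norm_num) h2
    refine ⟨padicValInt 2 m, by omega, ?_⟩
    have hRv : Rl (padicValInt 2 m) = R0 (padicValInt 2 m) := by
      simp only [hRl, min_eq_left hvle]
    rw [hRv, hdiff, hR0zpow]
    have : ((m : ℚ) : ℚ_[2]) = (m : ℚ_[2]) := by push_cast; rfl
    rw [← this, Padic.norm_eq_zpow_neg_valuation (by exact_mod_cast hm0), Padic.valuation_ratCast,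
      padicValRat.of_int]
  -- (c) the jets at the nodes (`‖1/k!‖₂ ≤ 2ᵏ ≤ 2^{t−1}`)
  set εj : ℝ := Bw * (2 * ‖S.Λ₀‖) * Pt with hεj
  have hεj0 : 0 ≤ εj := by positivity
  have hjet : ∀ a ∈ nodes, ∀ k < t, ‖∑' n, PadicNewton.ddList (List.replicate k a) b n * a ^ n‖ ≤ εj := by
    intro a ha k hkt
    obtain ⟨i, hi, rfl⟩ := hmem a ha
    have hj := S.norm_jet_g3F_le R u uθ B p hBw0 (hz2 _ (by simp only [hnode]; exact hint _)) (Tlo - 1)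
      (by positivity) (fun τ' hτ' => hval i hi τ' hτ') k τ (fun i' hi' k' => hBw i' hi' τ.1 k') (by omega)
    change ‖PadicNewton.jet _ b k‖ ≤ εj
    refine hj.trans ?_
    rw [hεj, mul_comm]
    refine mul_le_mul_of_nonneg_left ?_ (by positivity)
    exact (norm_inv_factorial_le_two_pow k).trans (pow_le_pow_right₀ (by norm_num) (by omega))
  -- the node sequence: each node `t` times
  have hcast_inj : Function.Injective node := by
    intro i i' hii'
    simp only [hnode] at hii'
    have h' : ((i : ℤ) - N : ℤ) = (i' : ℤ) - N := by exact_mod_cast (Int.cast_injective (α := ℚ_[2]) hii')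
    have : (i : ℤ) = i' := by omega
    exact_mod_cast this
  set xs : List ℚ_[2] := nodeSeq node kpts t with hxs
  have hxs_mem : ∀ x ∈ xs, x ∈ nodes := by
    intro x hx
    obtain ⟨i, hi, rfl⟩ := mem_nodeSeq hx
    exact mem_image.mpr ⟨i, by simpa using hi, rfl⟩
  have hxs_len : xs.length = kpts * t := length_nodeSeq node kpts t
  have hxs_cnt : ∀ a ∈ nodes, xs.count a ≤ t := by
    intro a ha
    obtain ⟨i, hi, rfl⟩ := hmem a ha
    rw [hxs, count_nodeSeq hcast_inj t kpts i, if_pos hi]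
  -- (c') the conditioning: nodes within `2^{-j}` of `node i₀` agree with it mod `2^j`
  have hball : ∀ j : ℕ, 1 ≤ j → PadicNewton.ballCount nodes (R0 j) xs ≤ t * (kpts / 2 ^ j + 1) := by
    intro j hj
    unfold PadicNewton.ballCount
    refine Finset.sup_le fun a ha => ?_
    obtain ⟨i₀, hi₀, rfl⟩ := hmem a ha
    rw [hxs, countP_nodeSeq]
    have hsub : ∀ i ∈ range kpts, decide (‖node i - node i₀‖ ≤ R0 j) = true →
        i % 2 ^ j = i₀ % 2 ^ j := by
      intro i _ hdec
      have hle : ‖node i - node i₀‖ ≤ R0 j := of_decide_eq_true hdec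
      rw [hdiff, hR0zpow, Padic.norm_int_le_pow_iff_dvd] at hle
      have hmod : i₀ ≡ i [MOD 2 ^ j] := Nat.modEq_iff_dvd.mpr (by push_cast; exact hle)
      exact hmod.symm
    calc ∑ i ∈ range kpts, (if decide (‖node i - node i₀‖ ≤ R0 j) = true then t else 0)
        ≤ ∑ i ∈ range kpts, (if i % 2 ^ j = i₀ % 2 ^ j then t else 0) := by
          refine sum_le_sum fun i hi => ?_
          by_cases hd : decide (‖node i - node i₀‖ ≤ R0 j) = true
          · rw [if_pos hd, if_pos (hsub i hi hd)]
          · rw [if_neg hd]; positivity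
      _ = t * ((range kpts).filter fun i => i % 2 ^ j = i₀ % 2 ^ j).card := by
          rw [← Finset.sum_filter]; simp [mul_comm]
      _ ≤ t * (kpts / 2 ^ j + 1) := Nat.mul_le_mul_left _ (card_filter_range_mod_le kpts _ _)
  have hcond : ∏ j ∈ range (Jm + 1), (Rl j / Rl (j + 1)) ^ PadicNewton.ballCount nodes (Rl (j + 1)) xs ≤
      (2 : ℝ) ^ condExp 2 kpts t := by
    rw [Finset.prod_range_succ]
    have hlast : Rl Jm / Rl (Jm + 1) = 1 := by
      simp only [hRl, min_eq_left (le_refl Jm), min_eq_right (Nat.le_succ Jm), div_self (hR0pos _).ne']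
    rw [hlast, one_pow, mul_one]
    have hin : ∀ j ∈ range Jm, (Rl j / Rl (j + 1)) ^ PadicNewton.ballCount nodes (Rl (j + 1)) xs =
        (2 : ℝ) ^ PadicNewton.ballCount nodes (R0 (j + 1)) xs := by
      intro j hj
      have hj' : j + 1 ≤ Jm := mem_range.mp hj
      simp only [hRl, min_eq_left (Nat.le_of_succ_le hj'), min_eq_left hj', hR0ratio]
    rw [Finset.prod_congr rfl hin, Finset.prod_pow_eq_pow_sum]
    refine pow_le_pow_right₀ (by norm_num) ?_
    have hJm' : Jm ≤ Nat.log 2 (2 * kpts) := Nat.log_mono_right (by omega)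
    unfold condExp
    calc ∑ j ∈ range Jm, PadicNewton.ballCount nodes (R0 (j + 1)) xs
        ≤ ∑ j ∈ range Jm, t * (kpts / 2 ^ (j + 1) + 1) := sum_le_sum fun j _ => hball (j + 1) (by omega)
      _ ≤ ∑ j ∈ range (Nat.log 2 (2 * kpts)), t * (kpts / 2 ^ (j + 1) + 1) :=
          sum_le_sum_of_subset_of_nonneg
            (fun j hj => mem_range.mpr (lt_of_lt_of_le (mem_range.mp hj) hJm')) fun _ _ _ => Nat.zero_le _
  -- (d) the small-jets Schwarz lemma (level version) at `z`
  have hschwarz := PadicNewton.norm_tsum_le_max_of_small_jets_levels hρ h1ρ le_rfl hbB nodes hnod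
    Rl hRl0 hRlpos hRlanti (Jm + 1) hlev hεj0 hjet xs hxs_mem hxs_cnt hz
  have hzlt : ‖z‖ < 4 := lt_of_le_of_lt hz (by norm_num)
  have hF : ‖S.g3F R u uθ B p τ z‖ ≤
      max (εj * ∏ j ∈ range (Jm + 1), (Rl j / Rl (j + 1)) ^ PadicNewton.ballCount nodes (Rl (j + 1)) xs)
        (Bw / ρ ^ xs.length * (xs.map fun x => ‖z - x‖).prod) := by
    rw [S.g3F_eq_tsum R u uθ B p τ hzlt]; exact hschwarz
  -- simplify the two terms
  have hprod : (xs.map fun x => ‖z - x‖).prod ≤ 1 := by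
    have h := List.prod_map_le_prod_map₀ (s := xs) (fun x => ‖z - x‖)
      (fun _ => (1 : ℝ)) (fun x _ => norm_nonneg _) (fun x hx => by
        rw [sub_eq_add_neg]
        exact (norm_add_le_max _ _).trans (max_le hz (by rw [norm_neg]; exact hnod x (hxs_mem x hx))))
    simpa using h
  have hPt2 : (2 : ℝ) * Pt = (2 : ℝ) ^ t := by
    rw [hPt, ← pow_succ', Nat.sub_add_cancel ht]
  have hterm1 : εj * ∏ j ∈ range (Jm + 1), (Rl j / Rl (j + 1)) ^ PadicNewton.ballCount nodes (Rl (j + 1)) xs ≤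
      Bw * ‖S.Λ₀‖ * (2 : ℝ) ^ t * (2 : ℝ) ^ condExp 2 kpts t := by
    have e : εj = Bw * ‖S.Λ₀‖ * (2 : ℝ) ^ t := by rw [hεj, ← hPt2]; ring
    rw [e]
    exact mul_le_mul_of_nonneg_left hcond (by positivity)
  have hterm2 : Bw / ρ ^ xs.length * (xs.map fun x => ‖z - x‖).prod ≤ Bw / ρ ^ (kpts * t) := by
    rw [hxs_len]
    exact mul_le_of_le_one_right (by positivity) hprod
  have hF' : ‖S.g3F R u uθ B p τ z‖ ≤
      max (Bw * ‖S.Λ₀‖ * (2 : ℝ) ^ t * (2 : ℝ) ^ condExp 2 kpts t) (Bw / ρ ^ (kpts * t)) :=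
    hF.trans (max_le_max hterm1 hterm2)
  refine ⟨hF', ?_⟩
  -- `‖φ‖ ≤ max(‖f‖, ‖f − φ‖)`
  have e : S.g3Φ R u uθ B p τ z = S.g3F R u uθ B p τ z + -(S.g3F R u uθ B p τ z - S.g3Φ R u uθ B p τ z) := by
    ring
  rw [e]
  refine (norm_add_le_max _ _).trans (max_le hF' ?_)
  rw [norm_neg]
  refine (hFΦ τ _ hz).trans (le_max_of_le_left ?_)
  have h1 : (2 : ℝ) ≤ (2 : ℝ) ^ t := by
    calc (2 : ℝ) = 2 ^ 1 := (pow_one _).symm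
      _ ≤ 2 ^ t := pow_le_pow_right₀ (by norm_num) ht
  have h2 : (1 : ℝ) ≤ (2 : ℝ) ^ condExp 2 kpts t := one_le_pow₀ (by norm_num)
  calc Bw * (2 * ‖S.Λ₀‖) = Bw * ‖S.Λ₀‖ * 2 * 1 := by ring
    _ ≤ Bw * ‖S.Λ₀‖ * (2 : ℝ) ^ t * (2 : ℝ) ^ condExp 2 kpts t := by gcongr

/-! ### The k-step -/

/-- **The `2`-adic k-step of the Gen-3 frame** (twin of `padic_kstep3`).  If the rational values
`g3φ τ'' x` vanish for `|x| ≤ N`, `|τ''| < Tlo`, the `Y₀`-weights satisfy the weighted bound `Bw`, the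
record's Liouville datum at the new points `|x₁| ≤ N'`, `|τ| + t ≤ Tlo` is
`K(x₁, τ) ≥ #B·P·M₀·Xb^{|t|}·monDen(x₁)²` (`PadicG3TwoValues.g3φ_eq_zero_of_norm_lt`), and
`max (Bw·‖Λ₀‖·2ᵗ·2^{condExp 2 (2N+1) t}) (Bw / 4^{(2N+1)t}) < 1/K(x₁, τ)`, then `g3φ τ x₁ = 0` there.
[cite: Yu2013, Lemma 5.2] [cite: Yu1990, §3] -/
theorem g3_kstep (B : Finset ι) (p : ι → ℤ) {N N' Tlo t : ℕ} (ht : 1 ≤ t)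
    {Bw : ℝ} (hBw0 : 0 ≤ Bw) (hBw : ∀ i ∈ B, ∀ t₀ k, ‖(hw R i t₀).coeff k‖ * 4 ^ k ≤ Bw)
    (hzero : ∀ x : ℤ, |x| ≤ (N : ℤ) → ∀ τ'' : Tau S.d, tauNorm τ'' < Tlo →
      S.g3φ R u uθ B p τ'' x = 0)
    {Dbox : Fin S.d → ℕ} {Dθ : ℕ} (hu : ∀ i ∈ B, ∀ j, |u i j| ≤ (Dbox j : ℤ))
    (huθ : ∀ i ∈ B, |uθ i| ≤ (Dθ : ℤ))
    (den₀ : ℤ → Tau S.d → ℕ) (hden₀ : ∀ x τ, 1 ≤ den₀ x τ) {M₀ : ℤ}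
    (hR : ∀ (x : ℤ) (τ : Tau S.d), ∀ i ∈ B,
      ∃ z₀ : ℤ, (den₀ x τ : ℚ) * (hasseDeriv τ.1 (R i)).eval (x : ℚ) = z₀ ∧ |z₀| ≤ M₀)
    {Xb : ℤ} (hX : ∀ i ∈ B, ∀ j, |S.dirScalar (u i) (uθ i) j| ≤ Xb) {P : ℤ} (hP : ∀ i ∈ B, |p i| ≤ P)
    (K : ℤ → Tau S.d → ℝ) (hK0 : ∀ x τ, 0 < K x τ)
    (hK : ∀ (x : ℤ) (τ : Tau S.d), (B.card : ℝ) * P * (M₀ * (Xb : ℝ) ^ (∑ j, τ.2 j) *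
      ((MonomialDen.monDen S.toQ.all (S.boxExp Dbox Dθ x) : ℝ)) ^ 2) ≤ K x τ)
    (hfinal : ∀ x₁ : ℤ, |x₁| ≤ (N' : ℤ) → ∀ τ : Tau S.d, tauNorm τ + t ≤ Tlo →
      max (Bw * ‖S.Λ₀‖ * (2 : ℝ) ^ t * (2 : ℝ) ^ condExp 2 (2 * N + 1) t)
        (Bw / (4 : ℝ) ^ ((2 * N + 1) * t)) < 1 / K x₁ τ) :
    ∀ x₁ : ℤ, |x₁| ≤ (N' : ℤ) → ∀ τ : Tau S.d, tauNorm τ + t ≤ Tlo →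
      S.g3φ R u uθ B p τ x₁ = 0 := by
  intro x₁ hx₁ τ hτ
  have hz : ‖((x₁ : ℤ) : ℚ_[2])‖ ≤ 1 := Padic.norm_int_le_one (p := 2) x₁
  have hcore := (S.norm_g3F_le_of_zeros R u uθ B p ht hBw0 hBw hzero hz τ hτ).2
  rw [S.g3Φ_intCast] at hcore
  exact S.g3φ_eq_zero_of_norm_lt R u uθ B p hu huθ τ x₁ (hden₀ x₁ τ) (hR x₁ τ) hX hP (hK x₁ τ)
    (hK0 x₁ τ) (lt_of_le_of_lt hcore (hfinal x₁ hx₁ τ hτ))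

end TwoSetup

end Summit.ABC.StewartYu

end
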